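import Mathlib
import Summits.MatrixMultiplication.MatrixMultiplication.Theses.SnSubsetDichotomy
import Summits.MatrixMultiplication.MatrixMultiplication.Theorems.SnSubsetDichotomyJuntaBranchStubRegularity
import Summits.MatrixMultiplication.MatrixMultiplication.Theorems.SnSubsetDichotomyUmvirateDescent
import Literature.Combinatorics.Additive.TPPGroupAlgebra

/-!
# Line `envelope-stability` — checked skeleton for crux `JuntaBranch` (stmt-MatrixMultiplication-8304)

Route `SnSubsetDichotomy`, crux decl
`Summit.MatrixMultiplication.MatrixMultiplication.Theses.SnSubsetDichotomy.JuntaBranch` (rank 3, fixed).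
Crux-plan round 1 for idea card `Ideas/envelope-stability.md` (triage TRIAGE-r1-{1,2,3}.md);
lead reshapes r0 (stub signatures unfolded to route vocabulary) and r1 (structural stubs merged),
line lead `prover-line-stmt-MatrixMultiplication-8304-0`, 2026-08-16.

## The line in one paragraph

`JuntaBranch` says: a near-threshold (`Large`) TPP triple of `S_n` with a super-neutral umvirate bump
(`BumpAt`, level `1 ≤ t ≤ √n`) is beaten, by the factor `e^{c+1}` in normalised volume, by SOME TPP triple
`√n` levels down (`Improves`).  The envelope-stability viewpoint: a triple that is NOT beaten from below is,
by the one-point REGULARITY of the volume function (`stub_regularity`: `maxVol(n) ≤ n³·maxVol(n-1)`,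
triage T4; LANDED p85676), within the factor `K = e^{c+1} n^{3/2}` of volume-MAXIMAL at its own level
(`NearMax`), and it may be taken inclusion-SATURATED (partners maximal, `S` maximal inside its bump
umvirate; `exists_saturated`, landed in `Theorems/SnSubsetDichotomyJuntaBranchOfNearMax.lean`).  What is left is ONE stability statement about saturated
near-maximisers, `stub_nearMaxImproves` = the crux restricted to such triples ("JB_nearmax", triage
r1-2 T5), which the composition `JuntaBranch_of` turns back into the crux; a cashing common-target
block (`stub_cash` = UmvirateDescent + window arithmetic, LANDED p87211) is the intended way to prove
it, and the same-target packing caps (`Theorems.JuntaBranch.sameTarget_cube_cap` etc., LANDED p88826)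
bound what any such block can deliver.  History: the planner's skeleton cut the residue in two by the
bump level (`stub_lowGain` for `t < ⌈4/ε⌉`: a cashing block at a bounded level; `stub_exchange` for
`t ≥ ⌈4/ε⌉`: a same-level competitor with `K` times the volume); wave 1 found both crux-sized with the
same missing ingredient (partners jointly `(1−ε)`-near-neutral at a target compatible with a
super-neutral block of `S` — no mechanism, no known `Large` family to test against), and the bounded-
level demand of `stub_lowGain` was stronger than the glue needs, so reshape r1 merges them.
The composition `JuntaBranch_of` is sorry-free and LANDED def-free as
`Theorems.JuntaBranch.juntaBranch_of_nearMaxImproves` (p89951): TPP cyclic symmetry (which set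
carries the bump), saturation by finite maximality with the bump preserved, antitonicity of
`Improves` in the volume, the regularity transfer `improves_of_sameLevel`.  Landed helpers of this
line (all `Theorems.JuntaBranch.*`): `stub_regularity` (p85676), `stub_cash` (p87211),
`pairPacking_first/outer/second`, `sameTarget_sq_cap`, `sameTarget_cube_cap` (p88826),
`exists_saturated`, `bump_transfer`, `improves_anti`, `improves_of_sameLevel`,
`juntaBranch_of_nearMaxImproves` (p89951).

Disproof obligations honoured (cdisprove Disproof.lean, notes of 2026-08-15/16; file body not mounted in
this seat): `juntaBranch_false_without_TPP` — TPP is a hypothesis of the residual stub and is USED by the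
landed stubs (descent heredity); `juntaBranch_false_without_n0` — the residual stub carries `∃ n₀`;
`withoutBump_iff_superDecay` — the bump is a hypothesis of the residual stub (nothing bump-free is
claimed); `not_sameLevelPropagationAt_four` — the residual stub spends `Large` (H2) and
near-maximality/saturation.  No landed Negative lemma exists for this crux.
-/

open Literature.Combinatorics.Additive

set_option linter.dupNamespace false
set_option linter.unusedVariables false
set_option autoImplicit false

namespace Summit.MatrixMultiplication.MatrixMultiplication.Cruxes.JuntaBranch.EnvelopeStability

open Summit.MatrixMultiplication.MatrixMultiplication.Theses.SnSubsetDichotomy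
open scoped Classical

/-! ## Vocabulary (transparent abbreviations of sub-expressions of the crux) -/

section Defs

variable {n : ℕ}

/-- `Large c S T U`: the crux's volume floor `(n!)^{3/2} e^{-c√n} ≤ |S||T||U|` (verbatim). -/
def Large (c : ℝ) (S T U : Finset (Equiv.Perm (Fin n))) : Prop :=
  (n.factorial : ℝ) ^ ((3 : ℝ) / 2) * Real.exp (-(c * Real.sqrt (n : ℝ))) ≤
    ((S.card * T.card * U.card : ℕ) : ℝ)

/-- `BumpAt ε X t I L`: the crux's super-neutral bump of `X` on the umvirate `U_{I→L}` (verbatim):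
`n^{(1/2+ε)t}·|X| < |X ∩ U_{I→L}|·n^{(t)}`. -/
def BumpAt (ε : ℝ) (X : Finset (Equiv.Perm (Fin n))) (t : ℕ) (I L : Fin t → Fin n) : Prop :=
  (n : ℝ) ^ ((1 / 2 + ε) * t) * (X.card : ℝ) <
    ((X.filter (fun σ => ∀ k, σ (I k) = L k)).card : ℝ) * (n.descFactorial t : ℝ)

/-- `Improves c S T U`: the crux's conclusion (verbatim) — some TPP triple at a level
`n' ∈ [n - √n, n)` has normalised volume `≥ e^{c+1}` times that of `(S,T,U)`. -/
def Improves (c : ℝ) (S T U : Finset (Equiv.Perm (Fin n))) : Prop :=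
  ∃ n' : ℕ, (n : ℝ) - Real.sqrt (n : ℝ) ≤ (n' : ℝ) ∧ n' < n ∧
    ∃ S' T' U' : Finset (Equiv.Perm (Fin n')), TripleProductProperty S' T' U' ∧
      Real.exp (c + 1) * ((S.card * T.card * U.card : ℕ) : ℝ) *
          ((n'.factorial : ℝ) / (n.factorial : ℝ)) ^ ((3 : ℝ) / 2) ≤
        ((S'.card * T'.card * U'.card : ℕ) : ℝ)

/-- `JointGain c S T U t L I J P`: the common-target block `(I→L, J→L, P→L)` CASHES — after
`UmvirateDescent` (route item 8308) to `S_{n-t}` it is an `Improves`-witness with `n' = n - t`: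
`e^{c+1}·|S||T||U|·((n-t)!/n!)^{3/2} ≤ |S∩U_{I→L}|·|T∩U_{J→L}|·|U∩U_{P→L}|`. -/
def JointGain (c : ℝ) (S T U : Finset (Equiv.Perm (Fin n))) (t : ℕ) (L I J P : Fin t → Fin n) : Prop :=
  Real.exp (c + 1) * ((S.card * T.card * U.card : ℕ) : ℝ) *
      ((((n - t).factorial : ℕ) : ℝ) / (n.factorial : ℝ)) ^ ((3 : ℝ) / 2) ≤
    (((S.filter (fun σ => ∀ k, σ (I k) = L k)).card *
        (T.filter (fun σ => ∀ k, σ (J k) = L k)).card *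
        (U.filter (fun σ => ∀ k, σ (P k) = L k)).card : ℕ) : ℝ)

/-- `PartnerSaturated S T U`: the partners `T`, `U` are inclusion-maximal given the other two sets
(every outsider breaks the TPP).  WLOG for the crux (tree lemma `Theorems.JuntaBranch.exists_saturated`). -/
def PartnerSaturated (S T U : Finset (Equiv.Perm (Fin n))) : Prop :=
  (∀ g, g ∉ T → ¬ TripleProductProperty S (insert g T) U) ∧
    (∀ g, g ∉ U → ¬ TripleProductProperty S T (insert g U))

/-- `BumpSaturated S T U t I L`: `S` is inclusion-maximal INSIDE the bump umvirate `U_{I→L}` (adding an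
element of the umvirate breaks the TPP).  WLOG, and it only fattens the bump (tree lemmas
`Theorems.JuntaBranch.exists_saturated`, `bump_transfer`). -/
def BumpSaturated (S T U : Finset (Equiv.Perm (Fin n))) (t : ℕ) (I L : Fin t → Fin n) : Prop :=
  ∀ g, g ∉ S → (∀ k, g (I k) = L k) → ¬ TripleProductProperty (insert g S) T U

/-- `NearMax c S T U`: `(S,T,U)` is within the factor `K = e^{c+1} n^{3/2}` of volume-maximal among ALL
TPP triples of the same `S_n`.  A triple that is not improved from below is near-maximal in this sense
(tree lemma `Theorems.JuntaBranch.improves_of_sameLevel`, via `stub_regularity`) — the envelope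
transfer of the card. -/
def NearMax (c : ℝ) (S T U : Finset (Equiv.Perm (Fin n))) : Prop :=
  ∀ S₁ T₁ U₁ : Finset (Equiv.Perm (Fin n)), TripleProductProperty S₁ T₁ U₁ →
    ((S₁.card * T₁.card * U₁.card : ℕ) : ℝ) <
      Real.exp (c + 1) * (n : ℝ) ^ ((3 : ℝ) / 2) * ((S.card * T.card * U.card : ℕ) : ℝ)

end Defs

/-! ## The obligations (statements), then the registered stubs -/

namespace Obligation

/-- Statement of `stub_regularity`. -/
def stub_regularity : Prop :=
  ∀ n : ℕ, 1 ≤ n → ∀ A B C : Finset (Equiv.Perm (Fin n)), TripleProductProperty A B C →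
    ∃ A' B' C' : Finset (Equiv.Perm (Fin (n - 1))), TripleProductProperty A' B' C' ∧
      ((A.card * B.card * C.card : ℕ) : ℝ) ≤ (n : ℝ) ^ (3 : ℕ) * ((A'.card * B'.card * C'.card : ℕ) : ℝ)

/-- Statement of `stub_cash`. -/
def stub_cash : Prop :=
  ∀ (n : ℕ) (c : ℝ) (S T U : Finset (Equiv.Perm (Fin n))), TripleProductProperty S T U →
    ∀ t : ℕ, 1 ≤ t → (t : ℝ) ≤ Real.sqrt (n : ℝ) → ∀ L I J P : Fin t → Fin n,
      Function.Injective L → Function.Injective I → Function.Injective J → Function.Injective P →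
      JointGain c S T U t L I J P → Improves c S T U

/-- Statement of `stub_nearMaxImproves` (lead reshape r1, 2026-08-16: the two structural stubs
`stub_lowGain` (bounded levels, cashing block at a bounded level) and `stub_exchange` (high levels,
same-level competitor) of the planner's skeleton are MERGED into the single residual obligation
below — the crux restricted to partner-saturated, bump-saturated, `K`-near-maximal triples
(`K = e^{c+1} n^{3/2}`), with the crux's own conclusion.  Both former stubs implied it on their
regimes (via `stub_cash`, resp. by contradiction with `NearMax`), both were diagnosed crux-sized
(worker reply `stub-blocked: crux-sized` for `stub_lowGain`; lead analysis for `stub_exchange`),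
and the bounded-level restriction of `stub_lowGain` was stronger than the composition needs.) -/
def stub_nearMaxImproves : Prop :=
  ∀ ε : ℝ, 0 < ε → ∀ c : ℝ, 0 < c → ∃ n₀ : ℕ, ∀ n ≥ n₀, ∀ S T U : Finset (Equiv.Perm (Fin n)),
    TripleProductProperty S T U → Large c S T U → PartnerSaturated S T U → NearMax c S T U →
    ∀ t : ℕ, 1 ≤ t → (t : ℝ) ≤ Real.sqrt (n : ℝ) → ∀ I L : Fin t → Fin n,
      Function.Injective I → Function.Injective L → BumpAt ε S t I L → BumpSaturated S T U t I L →
      Improves c S T U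

end Obligation

/-- **stub_regularity** (one-point REGULARITY of TPP volume; triage T4; size M; LANDED p85676 as
`Theorems.JuntaBranch.stub_regularity`, file `Theorems/SnSubsetDichotomyJuntaBranchStubRegularity.lean`).
Every TPP triple of `S_n` (`n ≥ 1`) descends to a TPP triple of `S_{n-1}` keeping a `1/n³` fraction of
its volume: fix a target point `l`; the atoms `A ∩ U_{i→l}` (`i ∈ [n]`) partition `A`, so the heaviest has
`≥ |A|/n` elements, likewise for `B`, `C`; right-translate the three atoms into `Stab(l) ≅ S_{n-1}`
(`UmvirateDescent`, route item 8308, at `t = 1`; TPP is hereditary — `TripleProductProperty.mono` — and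
invariant under `(A,B,C) ↦ (Aa,Bb,Cc)`).  Consequence used by the glue: `maxVol(n) ≤ n³·maxVol(n-1)`,
so "not improved from below by `e^{c+1}`" implies "within `e^{c+1} n^{3/2}` of maximal at level `n`".
Empty sets: volume `0`, take the empty triple. -/
theorem stub_regularity :
    ∀ n : ℕ, 1 ≤ n → ∀ A B C : Finset (Equiv.Perm (Fin n)), TripleProductProperty A B C →
    ∃ A' B' C' : Finset (Equiv.Perm (Fin (n - 1))), TripleProductProperty A' B' C' ∧
      ((A.card * B.card * C.card : ℕ) : ℝ) ≤
        (n : ℝ) ^ (3 : ℕ) * ((A'.card * B'.card * C'.card : ℕ) : ℝ) := by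
  exact Summit.MatrixMultiplication.MatrixMultiplication.Theorems.JuntaBranch.stub_regularity

/-- **stub_cash** (CASHING a gaining block = `UmvirateDescent` + window arithmetic; size M; LANDED p87211 as
`Theorems.JuntaBranch.stub_cash`, file `Theorems/SnSubsetDichotomyJuntaBranchStubCash.lean`).
If the common-target block `(I→L, J→L, P→L)` of level `1 ≤ t ≤ √n` has `JointGain c` then the crux's
conclusion holds with `n' = n - t`: route item `UmvirateDescent` (8308) gives a TPP triple of `S_{n-t}`
with exactly the three atom cardinalities, `n - √n ≤ n - t < n`, and `JointGain` is literally the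
required inequality (`(n-t)! = n'!`).  No density hypothesis, every `n`. -/
theorem stub_cash :
    ∀ (n : ℕ) (c : ℝ) (S T U : Finset (Equiv.Perm (Fin n))), TripleProductProperty S T U →
    ∀ t : ℕ, 1 ≤ t → (t : ℝ) ≤ Real.sqrt (n : ℝ) → ∀ L I J P : Fin t → Fin n,
      Function.Injective L → Function.Injective I → Function.Injective J → Function.Injective P →
      Real.exp (c + 1) * ((S.card * T.card * U.card : ℕ) : ℝ) *
          ((((n - t).factorial : ℕ) : ℝ) / (n.factorial : ℝ)) ^ ((3 : ℝ) / 2) ≤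
        (((S.filter (fun σ => ∀ k, σ (I k) = L k)).card *
            (T.filter (fun σ => ∀ k, σ (J k) = L k)).card *
            (U.filter (fun σ => ∀ k, σ (P k) = L k)).card : ℕ) : ℝ) →
      ∃ n' : ℕ, (n : ℝ) - Real.sqrt (n : ℝ) ≤ (n' : ℝ) ∧ n' < n ∧
        ∃ S' T' U' : Finset (Equiv.Perm (Fin n')), TripleProductProperty S' T' U' ∧
          Real.exp (c + 1) * ((S.card * T.card * U.card : ℕ) : ℝ) *
              ((n'.factorial : ℝ) / (n.factorial : ℝ)) ^ ((3 : ℝ) / 2) ≤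
            ((S'.card * T'.card * U'.card : ℕ) : ℝ) := by
  -- LANDED as `Theorems.JuntaBranch.stub_cash` (p87211); the proof is repeated here only so that this
  -- workfile elaborates on a farm snapshot that predates that module.
  intro n c S T U hTPP t ht hts L I J P hL hI hJ hP hgain
  have ht1 : (1 : ℝ) ≤ (t : ℝ) := by exact_mod_cast ht
  have hn0 : (0 : ℝ) ≤ (n : ℝ) := Nat.cast_nonneg n
  have hn1 : (1 : ℝ) ≤ (n : ℝ) := by
    have h1 : (1 : ℝ) ≤ Real.sqrt (n : ℝ) := le_trans ht1 hts
    have h2 : Real.sqrt (n : ℝ) * Real.sqrt (n : ℝ) = (n : ℝ) := Real.mul_self_sqrt hn0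
    nlinarith [h1, h2]
  have hsqrt_le : Real.sqrt (n : ℝ) ≤ (n : ℝ) := by
    rw [Real.sqrt_le_left hn0]
    nlinarith [hn1]
  have htn_real : (t : ℝ) ≤ (n : ℝ) := le_trans hts hsqrt_le
  have htn : t ≤ n := by exact_mod_cast htn_real
  have hn_pos : 0 < n := by
    have : (0 : ℝ) < (n : ℝ) := lt_of_lt_of_le one_pos hn1
    exact_mod_cast this
  obtain ⟨S', T', U', hTPP', hS', hT', hU'⟩ :=
    Summit.MatrixMultiplication.MatrixMultiplication.Theorems.umvirateDescent_proof n t htn I J P L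
      hI hJ hP hL S T U hTPP
  refine ⟨n - t, ?_, Nat.sub_lt hn_pos ht, S', T', U', hTPP', ?_⟩
  · rw [Nat.cast_sub htn]
    linarith [hts]
  · rw [hS', hT', hU']
    exact hgain

/-- **stub_nearMaxImproves** (THE RESIDUAL OBLIGATION — stability of saturated near-maximisers;
lead reshape r1 merging `stub_lowGain` and `stub_exchange`; size XL = crux-sized).
For `n ≥ n₀(ε,c)`: a TPP triple that is `Large` (volume floor `(n!)^{3/2}e^{-c√n}`), whose partners
`T`, `U` are inclusion-saturated, which is within the factor `K = e^{c+1} n^{3/2}` of volume-maximal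
among all TPP triples of the same `S_n` (`NearMax`, the hypothesis the glue derives from
`¬Improves` by `stub_regularity`), and whose first set has an `ε`-super-neutral bump at a level
`1 ≤ t ≤ √n` (saturated inside the bump umvirate), satisfies the crux's conclusion `Improves`:
some TPP triple at a level `n' ∈ [n − √n, n)` has `e^{c+1}` times its normalised volume.
This is `JuntaBranch` restricted to saturated near-maximisers ("JB_nearmax", triage r1-2 T5); the
composition `JuntaBranch_of` proves `JB_nearmax ⇒ JuntaBranch` (the converse is trivial), so the
statement is EQUIVALENT to the crux and carries all of its open content.  The intended mechanism
is a CASHING common-target block (`stub_cash`, landed): partners jointly `(1−ε)`-near-neutral at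
some target compatible with a super-neutral block of `S` (`R_T·R_U ≥ e^{c+1} n^{(1−ε)t'}` where
`R_S ≥ n^{(1/2+ε)t'}`); counting alone gives only `max_J R_T ≥ 1` (pigeonhole over the `n^{(t)}`
atoms) and UPPER caps (`Theorems.JuntaBranch.pairPacking_*`, `sameTarget_sq_cap`,
`sameTarget_cube_cap`, landed p88826: through the bumped block the gain is `< e^{2c√n} n^{−εt}`,
so the cashing block is in general NOT the bumped one), volume-free propagation is false
(cdisprove `not_sameLevelPropagationAt_four`), and `Large c` is not known to be satisfiable at any
fixed `c` (BCCGU17 §4), so neither a proof nor a refutation is available today. -/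
theorem stub_nearMaxImproves :
    ∀ ε : ℝ, 0 < ε → ∀ c : ℝ, 0 < c → ∃ n₀ : ℕ, ∀ n ≥ n₀, ∀ S T U : Finset (Equiv.Perm (Fin n)),
    TripleProductProperty S T U →
    (n.factorial : ℝ) ^ ((3 : ℝ) / 2) * Real.exp (-(c * Real.sqrt (n : ℝ))) ≤
      ((S.card * T.card * U.card : ℕ) : ℝ) →
    ((∀ g, g ∉ T → ¬ TripleProductProperty S (insert g T) U) ∧
      (∀ g, g ∉ U → ¬ TripleProductProperty S T (insert g U))) →
    (∀ S₁ T₁ U₁ : Finset (Equiv.Perm (Fin n)), TripleProductProperty S₁ T₁ U₁ →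
      ((S₁.card * T₁.card * U₁.card : ℕ) : ℝ) <
        Real.exp (c + 1) * (n : ℝ) ^ ((3 : ℝ) / 2) * ((S.card * T.card * U.card : ℕ) : ℝ)) →
    ∀ t : ℕ, 1 ≤ t → (t : ℝ) ≤ Real.sqrt (n : ℝ) → ∀ I L : Fin t → Fin n,
      Function.Injective I → Function.Injective L →
      (n : ℝ) ^ ((1 / 2 + ε) * t) * (S.card : ℝ) <
        ((S.filter (fun σ => ∀ k, σ (I k) = L k)).card : ℝ) * (n.descFactorial t : ℝ) →
      (∀ g, g ∉ S → (∀ k, g (I k) = L k) → ¬ TripleProductProperty (insert g S) T U) →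
      ∃ n' : ℕ, (n : ℝ) - Real.sqrt (n : ℝ) ≤ (n' : ℝ) ∧ n' < n ∧
        ∃ S' T' U' : Finset (Equiv.Perm (Fin n')), TripleProductProperty S' T' U' ∧
          Real.exp (c + 1) * ((S.card * T.card * U.card : ℕ) : ℝ) *
              ((n'.factorial : ℝ) / (n.factorial : ℝ)) ^ ((3 : ℝ) / 2) ≤
            ((S'.card * T'.card * U'.card : ℕ) : ℝ) := by
  sorry

/-! ## Glue — LANDED def-free as `Theorems/SnSubsetDichotomyJuntaBranchOfNearMax.lean` (p89951);
repeated here (namespace `EnvelopeStability`) only so that this workfile elaborates on a farm snapshot that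
predates that module. -/

section Glue

/-- **Saturation** (finite maximality): a TPP triple `S, T, U ⊆ S_n` extends to a TPP triple
`S' ⊇ S, T' ⊇ T, U' ⊇ U` whose partners `T', U'` are inclusion-maximal, whose first set is maximal
inside the umvirate `U_{I→L}`, and whose new first-set elements all lie in that umvirate (take a
triple of maximal total size among the finitely many admissible ones). [folklore] -/
theorem exists_saturated {n t : ℕ} (S T U : Finset (Equiv.Perm (Fin n)))
    (hTPP : TripleProductProperty S T U) (I L : Fin t → Fin n) :
    ∃ S' T' U' : Finset (Equiv.Perm (Fin n)), S ⊆ S' ∧ T ⊆ T' ∧ U ⊆ U' ∧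
      TripleProductProperty S' T' U' ∧
      ((∀ g, g ∉ T' → ¬ TripleProductProperty S' (insert g T') U') ∧
        (∀ g, g ∉ U' → ¬ TripleProductProperty S' T' (insert g U'))) ∧
      (∀ g, g ∉ S' → (∀ k, g (I k) = L k) → ¬ TripleProductProperty (insert g S') T' U') ∧
      (∀ g ∈ S', g ∉ S → ∀ k, g (I k) = L k) := by
  set V : Finset (Equiv.Perm (Fin n)) := S ∪ Finset.univ.filter (fun g => ∀ k, g (I k) = L k)
    with hV
  set F : Finset (Finset (Equiv.Perm (Fin n)) × Finset (Equiv.Perm (Fin n)) ×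
      Finset (Equiv.Perm (Fin n))) :=
    Finset.univ.filter (fun x => S ⊆ x.1 ∧ x.1 ⊆ V ∧ T ⊆ x.2.1 ∧ U ⊆ x.2.2 ∧
      TripleProductProperty x.1 x.2.1 x.2.2) with hF
  have hmemF : ∀ x : Finset (Equiv.Perm (Fin n)) × Finset (Equiv.Perm (Fin n)) ×
      Finset (Equiv.Perm (Fin n)), x ∈ F ↔ (S ⊆ x.1 ∧ x.1 ⊆ V ∧ T ⊆ x.2.1 ∧ U ⊆ x.2.2 ∧
      TripleProductProperty x.1 x.2.1 x.2.2) := by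
    intro x
    simp only [hF, Finset.mem_filter, Finset.mem_univ, true_and]
  have h0 : (S, T, U) ∈ F := (hmemF _).2 ⟨subset_rfl, Finset.subset_union_left, subset_rfl,
    subset_rfl, hTPP⟩
  obtain ⟨x, hx, hmax⟩ := F.exists_max_image (fun x => x.1.card + x.2.1.card + x.2.2.card) ⟨_, h0⟩
  obtain ⟨hSx, hxV, hTx, hUx, hTPPx⟩ := (hmemF x).1 hx
  refine ⟨x.1, x.2.1, x.2.2, hSx, hTx, hUx, hTPPx, ⟨?_, ?_⟩, ?_, ?_⟩
  · intro g hg hTPP'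
    have hy : (x.1, insert g x.2.1, x.2.2) ∈ F :=
      (hmemF _).2 ⟨hSx, hxV, hTx.trans (Finset.subset_insert g x.2.1), hUx, hTPP'⟩
    have := hmax _ hy
    simp only [Finset.card_insert_of_notMem hg] at this
    omega
  · intro g hg hTPP'
    have hy : (x.1, x.2.1, insert g x.2.2) ∈ F :=
      (hmemF _).2 ⟨hSx, hxV, hTx, hUx.trans (Finset.subset_insert g x.2.2), hTPP'⟩
    have := hmax _ hy
    simp only [Finset.card_insert_of_notMem hg] at this
    omega
  · intro g hg hgP hTPP'
    have hgV : g ∈ V := by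
      rw [hV, Finset.mem_union, Finset.mem_filter]
      exact Or.inr ⟨Finset.mem_univ g, hgP⟩
    have hy : (insert g x.1, x.2.1, x.2.2) ∈ F :=
      (hmemF _).2 ⟨hSx.trans (Finset.subset_insert g x.1), Finset.insert_subset hgV hxV, hTx, hUx,
        hTPP'⟩
    have := hmax _ hy
    simp only [Finset.card_insert_of_notMem hg] at this
    omega
  · intro g hg hgS
    have hgV : g ∈ V := hxV hg
    rw [hV, Finset.mem_union, Finset.mem_filter] at hgV
    rcases hgV with h | ⟨-, h⟩
    · exact absurd h hgS
    · exact h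

/-- **Bump transfer**: enlarging `S` by elements of the bump umvirate `U_{I→L}` keeps the block
`(I→L)` super-neutral — `n^{(1/2+ε)t}|S| < |S ∩ U_{I→L}|·n^{(t)}` passes from `S` to `S'`.
[folklore] -/
theorem bump_transfer {n : ℕ} {ε : ℝ} {t : ℕ} {I L : Fin t → Fin n}
    {S S' : Finset (Equiv.Perm (Fin n))} (hsub : S ⊆ S')
    (hP : ∀ g ∈ S', g ∉ S → ∀ k, g (I k) = L k)
    (hb : (n : ℝ) ^ ((1 / 2 + ε) * t) * (S.card : ℝ) <
      ((S.filter (fun σ => ∀ k, σ (I k) = L k)).card : ℝ) * (n.descFactorial t : ℝ)) :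
    (n : ℝ) ^ ((1 / 2 + ε) * t) * (S'.card : ℝ) <
      ((S'.filter (fun σ => ∀ k, σ (I k) = L k)).card : ℝ) * (n.descFactorial t : ℝ) := by
  -- cardinal bookkeeping in ℕ
  have h3nat : (S' \ S).card + S.card = S'.card := Finset.card_sdiff_add_card_eq_card hsub
  have hdisj : Disjoint (S.filter (fun σ => ∀ k, σ (I k) = L k)) (S' \ S) :=
    Finset.disjoint_left.2 (fun g hg hg' => (Finset.mem_sdiff.1 hg').2 (Finset.mem_filter.1 hg).1)
  have hsub4 : S.filter (fun σ => ∀ k, σ (I k) = L k) ∪ (S' \ S) ⊆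
      S'.filter (fun σ => ∀ k, σ (I k) = L k) := by
    intro g hg
    rcases Finset.mem_union.1 hg with h | h
    · exact Finset.filter_subset_filter _ hsub h
    · obtain ⟨hgS', hgS⟩ := Finset.mem_sdiff.1 h
      exact Finset.mem_filter.2 ⟨hgS', hP g hgS' hgS⟩
  have h4nat : (S.filter (fun σ => ∀ k, σ (I k) = L k)).card + (S' \ S).card ≤
      (S'.filter (fun σ => ∀ k, σ (I k) = L k)).card := by
    rw [← Finset.card_union_of_disjoint hdisj]; exact Finset.card_le_card hsub4
  have h2nat : (S.filter (fun σ => ∀ k, σ (I k) = L k)).card ≤ S.card :=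
    Finset.card_le_card (Finset.filter_subset _ _)
  -- pass to ℝ
  set a : ℝ := (n : ℝ) ^ ((1 / 2 + ε) * t) with ha
  set D : ℝ := (n.descFactorial t : ℝ) with hD
  set s : ℝ := (S.card : ℝ) with hs
  set s' : ℝ := (S'.card : ℝ) with hs'
  set f : ℝ := ((S.filter (fun σ => ∀ k, σ (I k) = L k)).card : ℝ) with hf
  set f' : ℝ := ((S'.filter (fun σ => ∀ k, σ (I k) = L k)).card : ℝ) with hf'
  set e : ℝ := ((S' \ S).card : ℝ) with he
  have h3 : s' = s + e := by
    rw [hs', hs, he, ← h3nat]; push_cast; ring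
  have h4 : f + e ≤ f' := by rw [hf, he, hf']; exact_mod_cast h4nat
  have h2 : f ≤ s := by rw [hf, hs]; exact_mod_cast h2nat
  have hD0 : 0 ≤ D := Nat.cast_nonneg _
  have he0 : 0 ≤ e := Nat.cast_nonneg _
  have hs0 : 0 ≤ s := Nat.cast_nonneg _
  have haD : a ≤ D := by
    by_contra hlt
    push Not at hlt
    have h5 : f * D ≤ s * D := mul_le_mul_of_nonneg_right h2 hD0
    have h6 : s * D ≤ s * a := mul_le_mul_of_nonneg_left hlt.le hs0
    linarith
  calc a * s' = a * s + a * e := by rw [h3]; ring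
    _ < f * D + D * e := by
        have h7 : a * e ≤ D * e := mul_le_mul_of_nonneg_right haD he0
        linarith
    _ = (f + e) * D := by ring
    _ ≤ f' * D := mul_le_mul_of_nonneg_right h4 hD0

/-- **The conclusion of the crux is antitone in the volume.** [folklore] -/
theorem improves_anti {n : ℕ} {c : ℝ} {V W : ℕ} (h : V ≤ W)
    (hI : ∃ n' : ℕ, (n : ℝ) - Real.sqrt (n : ℝ) ≤ (n' : ℝ) ∧ n' < n ∧
      ∃ S' T' U' : Finset (Equiv.Perm (Fin n')), TripleProductProperty S' T' U' ∧
        Real.exp (c + 1) * (W : ℝ) * ((n'.factorial : ℝ) / (n.factorial : ℝ)) ^ ((3 : ℝ) / 2) ≤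
          ((S'.card * T'.card * U'.card : ℕ) : ℝ)) :
    ∃ n' : ℕ, (n : ℝ) - Real.sqrt (n : ℝ) ≤ (n' : ℝ) ∧ n' < n ∧
      ∃ S' T' U' : Finset (Equiv.Perm (Fin n')), TripleProductProperty S' T' U' ∧
        Real.exp (c + 1) * (V : ℝ) * ((n'.factorial : ℝ) / (n.factorial : ℝ)) ^ ((3 : ℝ) / 2) ≤
          ((S'.card * T'.card * U'.card : ℕ) : ℝ) := by
  obtain ⟨n', h1, h2, S', T', U', hTPP, hle⟩ := hI
  refine ⟨n', h1, h2, S', T', U', hTPP, le_trans ?_ hle⟩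
  have h' : (V : ℝ) ≤ (W : ℝ) := by exact_mod_cast h
  have h0 : (0 : ℝ) ≤ ((n'.factorial : ℝ) / (n.factorial : ℝ)) ^ ((3 : ℝ) / 2) := by positivity
  exact mul_le_mul_of_nonneg_right (mul_le_mul_of_nonneg_left h' (Real.exp_pos _).le) h0

/-- **Envelope transfer** (one-point regularity, working form): a same-level competitor with
`e^{c+1} n^{3/2}` times the volume is cashed one level down (`n' = n - 1`) by
`stub_regularity` (`maxVol(n) ≤ n³·maxVol(n-1)`). [folklore] -/
theorem improves_of_sameLevel {n : ℕ} (hn : 1 ≤ n) {c : ℝ} {V : ℕ}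
    {S₁ T₁ U₁ : Finset (Equiv.Perm (Fin n))} (h₁ : TripleProductProperty S₁ T₁ U₁)
    (hge : Real.exp (c + 1) * (n : ℝ) ^ ((3 : ℝ) / 2) * (V : ℝ) ≤
      ((S₁.card * T₁.card * U₁.card : ℕ) : ℝ)) :
    ∃ n' : ℕ, (n : ℝ) - Real.sqrt (n : ℝ) ≤ (n' : ℝ) ∧ n' < n ∧
      ∃ S' T' U' : Finset (Equiv.Perm (Fin n')), TripleProductProperty S' T' U' ∧
        Real.exp (c + 1) * (V : ℝ) * ((n'.factorial : ℝ) / (n.factorial : ℝ)) ^ ((3 : ℝ) / 2) ≤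
          ((S'.card * T'.card * U'.card : ℕ) : ℝ) := by
  obtain ⟨A, B, C, hABC, hle⟩ := stub_regularity n hn S₁ T₁ U₁ h₁
  refine ⟨n - 1, ?_, Nat.sub_lt hn one_pos, A, B, C, hABC, ?_⟩
  · rw [Nat.cast_sub hn, Nat.cast_one]
    have : (1 : ℝ) ≤ Real.sqrt n := Real.one_le_sqrt.2 (by exact_mod_cast hn)
    linarith
  · have hnpos : (0 : ℝ) < n := by exact_mod_cast hn
    have hfac : ((n - 1).factorial : ℝ) / (n.factorial : ℝ) = (n : ℝ)⁻¹ := by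
      obtain ⟨m, rfl⟩ : ∃ m, n = m + 1 := ⟨n - 1, by omega⟩
      have hm : ((m.factorial : ℕ) : ℝ) ≠ 0 := by exact_mod_cast m.factorial_ne_zero
      simp only [Nat.add_sub_cancel, Nat.factorial_succ, Nat.cast_mul, Nat.cast_add, Nat.cast_one]
      field_simp
    rw [hfac, Real.inv_rpow hnpos.le]
    set N : ℝ := (n : ℝ) ^ ((3 : ℝ) / 2) with hN
    set W : ℝ := ((A.card * B.card * C.card : ℕ) : ℝ) with hW
    have hNpos : 0 < N := Real.rpow_pos_of_pos hnpos _
    have hcube : (n : ℝ) ^ (3 : ℕ) = N * N := by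
      rw [hN, ← Real.rpow_add hnpos, ← Real.rpow_natCast]; norm_num
    rw [hcube] at hle
    have key : Real.exp (c + 1) * (V : ℝ) * N ≤ (N * W) * N := by
      calc Real.exp (c + 1) * (V : ℝ) * N = Real.exp (c + 1) * N * (V : ℝ) := by ring
        _ ≤ ((S₁.card * T₁.card * U₁.card : ℕ) : ℝ) := hge
        _ ≤ N * N * W := hle
        _ = (N * W) * N := by ring
    have key2 : Real.exp (c + 1) * (V : ℝ) ≤ N * W := le_of_mul_le_mul_right key hNpos
    calc Real.exp (c + 1) * (V : ℝ) * N⁻¹ = (Real.exp (c + 1) * (V : ℝ)) / N := by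
          rw [div_eq_mul_inv]
      _ ≤ (N * W) / N := div_le_div_of_nonneg_right key2 hNpos.le
      _ = W := mul_div_cancel_left₀ W hNpos.ne'

/-- The landed reduction `Theorems.JuntaBranch.juntaBranch_of_nearMaxImproves` (p89951), verbatim. -/
theorem juntaBranch_of_nearMaxImproves :
    (∀ ε : ℝ, 0 < ε → ∀ c : ℝ, 0 < c → ∃ n₀ : ℕ, ∀ n ≥ n₀, ∀ S T U : Finset (Equiv.Perm (Fin n)),
      TripleProductProperty S T U →
      (n.factorial : ℝ) ^ ((3 : ℝ) / 2) * Real.exp (-(c * Real.sqrt (n : ℝ))) ≤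
        ((S.card * T.card * U.card : ℕ) : ℝ) →
      ((∀ g, g ∉ T → ¬ TripleProductProperty S (insert g T) U) ∧
        (∀ g, g ∉ U → ¬ TripleProductProperty S T (insert g U))) →
      (∀ S₁ T₁ U₁ : Finset (Equiv.Perm (Fin n)), TripleProductProperty S₁ T₁ U₁ →
        ((S₁.card * T₁.card * U₁.card : ℕ) : ℝ) <
          Real.exp (c + 1) * (n : ℝ) ^ ((3 : ℝ) / 2) * ((S.card * T.card * U.card : ℕ) : ℝ)) →
      ∀ t : ℕ, 1 ≤ t → (t : ℝ) ≤ Real.sqrt (n : ℝ) → ∀ I L : Fin t → Fin n,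
        Function.Injective I → Function.Injective L →
        (n : ℝ) ^ ((1 / 2 + ε) * t) * (S.card : ℝ) <
          ((S.filter (fun σ => ∀ k, σ (I k) = L k)).card : ℝ) * (n.descFactorial t : ℝ) →
        (∀ g, g ∉ S → (∀ k, g (I k) = L k) → ¬ TripleProductProperty (insert g S) T U) →
        ∃ n' : ℕ, (n : ℝ) - Real.sqrt (n : ℝ) ≤ (n' : ℝ) ∧ n' < n ∧
          ∃ S' T' U' : Finset (Equiv.Perm (Fin n')), TripleProductProperty S' T' U' ∧
            Real.exp (c + 1) * ((S.card * T.card * U.card : ℕ) : ℝ) *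
                ((n'.factorial : ℝ) / (n.factorial : ℝ)) ^ ((3 : ℝ) / 2) ≤
              ((S'.card * T'.card * U'.card : ℕ) : ℝ)) →
    JuntaBranch := by
  intro hstab ε hε c hc
  obtain ⟨n₂, h₂⟩ := hstab ε hε c hc
  refine ⟨max 1 n₂, ?_⟩
  intro n hn S T U hTPP hLarge hBumpy
  have hn1 : 1 ≤ n := le_trans (le_max_left _ _) hn
  have hn2 : n₂ ≤ n := le_trans (le_max_right _ _) hn
  -- the core: a Large TPP triple whose FIRST set is bumpy is improved
  have core : ∀ A B C : Finset (Equiv.Perm (Fin n)), TripleProductProperty A B C →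
      (n.factorial : ℝ) ^ ((3 : ℝ) / 2) * Real.exp (-(c * Real.sqrt (n : ℝ))) ≤
        ((A.card * B.card * C.card : ℕ) : ℝ) →
      ∀ t : ℕ, 1 ≤ t → (t : ℝ) ≤ Real.sqrt (n : ℝ) → ∀ I L : Fin t → Fin n,
        Function.Injective I → Function.Injective L →
        (n : ℝ) ^ ((1 / 2 + ε) * t) * (A.card : ℝ) <
          ((A.filter (fun σ => ∀ k, σ (I k) = L k)).card : ℝ) * (n.descFactorial t : ℝ) →
        ∃ n' : ℕ, (n : ℝ) - Real.sqrt (n : ℝ) ≤ (n' : ℝ) ∧ n' < n ∧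
          ∃ S' T' U' : Finset (Equiv.Perm (Fin n')), TripleProductProperty S' T' U' ∧
            Real.exp (c + 1) * ((A.card * B.card * C.card : ℕ) : ℝ) *
                ((n'.factorial : ℝ) / (n.factorial : ℝ)) ^ ((3 : ℝ) / 2) ≤
              ((S'.card * T'.card * U'.card : ℕ) : ℝ) := by
    intro A B C hABC hLA t ht1 ht2 I L hI hL hbump
    by_contra hni
    -- saturate
    obtain ⟨A', B', C', hA, hB, hC, hTPP', hPS, hBS, hP⟩ := exists_saturated A B C hABC I L
    have hvol : A.card * B.card * C.card ≤ A'.card * B'.card * C'.card :=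
      Nat.mul_le_mul (Nat.mul_le_mul (Finset.card_le_card hA) (Finset.card_le_card hB))
        (Finset.card_le_card hC)
    have hLA' : (n.factorial : ℝ) ^ ((3 : ℝ) / 2) * Real.exp (-(c * Real.sqrt (n : ℝ))) ≤
        ((A'.card * B'.card * C'.card : ℕ) : ℝ) := hLA.trans (by exact_mod_cast hvol)
    have hbump' := bump_transfer (ε := ε) hA hP hbump
    -- not improved ⇒ near-maximal at the same level
    have hnear : ∀ S₁ T₁ U₁ : Finset (Equiv.Perm (Fin n)), TripleProductProperty S₁ T₁ U₁ →
        ((S₁.card * T₁.card * U₁.card : ℕ) : ℝ) <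
          Real.exp (c + 1) * (n : ℝ) ^ ((3 : ℝ) / 2) * ((A'.card * B'.card * C'.card : ℕ) : ℝ) := by
      intro S₁ T₁ U₁ h₁
      by_contra hge
      push Not at hge
      exact hni (improves_anti hvol (improves_of_sameLevel hn1 h₁ hge))
    exact hni (improves_anti hvol
      (h₂ n hn2 A' B' C' hTPP' hLA' hPS hnear t ht1 ht2 I L hI hL hbump' hBS))
  -- which set carries the bump: rotate it to the front
  obtain ⟨X, hX, t, ht1, ht2, I, L, hI, hL, hbump⟩ := hBumpy
  rcases hX with hXS | hXT | hXU
  · rw [hXS] at hbump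
    exact core S T U hTPP hLarge t ht1 ht2 I L hI hL hbump
  · rw [hXT] at hbump
    have hvolT : T.card * U.card * S.card = S.card * T.card * U.card := by ring
    have hL1 : (n.factorial : ℝ) ^ ((3 : ℝ) / 2) * Real.exp (-(c * Real.sqrt (n : ℝ))) ≤
        ((T.card * U.card * S.card : ℕ) : ℝ) := by rw [hvolT]; exact hLarge
    have h := core T U S hTPP.rotate hL1 t ht1 ht2 I L hI hL hbump
    rw [hvolT] at h
    exact h
  · rw [hXU] at hbump
    have hvolU : U.card * S.card * T.card = S.card * T.card * U.card := by ring
    have hL1 : (n.factorial : ℝ) ^ ((3 : ℝ) / 2) * Real.exp (-(c * Real.sqrt (n : ℝ))) ≤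
        ((U.card * S.card * T.card : ℕ) : ℝ) := by rw [hvolU]; exact hLarge
    have h := core U S T hTPP.rotate.rotate hL1 t ht1 ht2 I L hI hL hbump
    rw [hvolU] at h
    exact h


end Glue

/-! ## The composition: the residual obligation implies the crux, by name -/

/-- **Composition** (kernel-checked, sorry-free apart from the residual stub it is fed): stability
of saturated near-maximisers ⇒ `JuntaBranch`, i.e. the landed reduction
`juntaBranch_of_nearMaxImproves` (p89951; repeated above) applied to the obligation (the
`Obligation` def unfolds to its hypothesis verbatim). -/
theorem JuntaBranch_of (hstab : Obligation.stub_nearMaxImproves) : JuntaBranch :=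
  juntaBranch_of_nearMaxImproves hstab

/-- The residual stub has exactly the obligation type (this `example` re-checks the sync), so the
crux is closed MODULO `stub_nearMaxImproves` alone. -/
example : JuntaBranch := JuntaBranch_of stub_nearMaxImproves

/-- `stub_cash` and `stub_regularity` still have exactly their obligation types (landed tools). -/
example : Obligation.stub_cash := stub_cash

example : Obligation.stub_regularity := stub_regularity

end Summit.MatrixMultiplication.MatrixMultiplication.Cruxes.JuntaBranch.EnvelopeStability
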